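import Summits.HodgeConjecture.HodgeConjecture.Theorems.Ring2DeformUniformAlgebraicity
import Literature.AlgebraicGeometry.Deligne1982.CMDenseMumfordTateFamilies
import HarnessLib

/-!
# Ring 2 · route `deform`, III — the family inputs DISCHARGED to the refereed literature; the
# reduction item `CMToAbelian` read as a conditional spreading statement

HONEST FRAMING: research route conditional on HC_CM; not a corollary; Q11.4-sentence-2 already refuted in dim ≥ 3.

Cell `pub-hodge-ring2`, seat `pub-hodge-ring2-deform` (gen 4). `HC_CM` is ALWAYS the explicit hypothesis
`Theses.RankFourFaces.CMAbelianHodge` (tree item stmt-HodgeConjecture-3052) — a binder, never an axiom, never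
cited; `HC_AV` is `Theses.PadicSemiregularLift.HodgeAbelianVarieties` (stmt-HodgeConjecture-1333); the reduction
item "`HC_CM ⟹ HC_AV`" is `Theses.RankFourFaces.CMToAbelian` (stmt-HodgeConjecture-16267, OPEN — nothing here
closes it). Theorems only: NO definition, no `sorry`; axioms `propext`, `Classical.choice`, `Quot.sound`.

## What this part adds to parts I (`Ring2DeformVariationalInputs`) and II (`Ring2DeformSpreading`,
## `Ring2DeformUniformAlgebraicity`)

Parts I–II typed the family-existence inputs of Deligne's reduction as summit-side HYPOTHESES
(`Hypotheses.MumfordTateCMAnchors`: one CM fibre, Deligne 1982 Prop. 6.1; `Ring2.Deform.CMDenseMumfordTateFamilies`: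
Charles–Schnell Thm. 11.5.11 (a)(b)(c) WITH density). Both are refereed THEOREMS IN PRINT, since vendored by the
literature seat as NAMED FACTS on the same carriers (`Deligne1982.deligne1982_cmDenseMumfordTateFamilies`;
`Abdulali1994.deligne1982_exists_cmAnchoredHodgeFamily`, a consequence of the former). This file gives the
summit-side bridges and restates every row of the deform axis with the family input DISCHARGED to the cited
fact, so that between `HC_CM` and `HC_AV` exactly ONE typed open `Prop` remains per row:

* §A  BRIDGES (both directions, so nothing is over- or under-stated): `CMDenseMumfordTateFamilies ↔
  deligne1982_cmDenseMumfordTateFamilies` (`Iff.rfl`: same binders, same order, `cmLocus` bodies equal) and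
  `MumfordTateCMAnchors ↔ deligne1982_exists_cmAnchoredHodgeFamily` (repackaging; the CM clause of the
  summit node is `Milne1999.IsOfCMType` unfolded).
* §B  ROWS DISCHARGED: U `HC_AV ↔ HC_CM ∧ UniformAlgebraicityAtCMPoints`, H4 `HC_AV ↔ HC_CM ∧
  AlgebraicityLocusClosedOnCMDenseFamilies`, V `HC_AV ↔ HC_CM ∧ AbelianSchemeVHC` — each now modulo the
  refereed fact only; and Milne's endnote-19 domination row (M) `AbelianSchemeVHC ⟹ HC_AV` with NO `HC_CM`
  binder, modulo three refereed-print inputs (André 1992, Deligne's tensor-anchored Weil families, Prop. 6.1)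
  and the open anchored leaf R3anc of the Weil-type ladder.
* §C  THE ITEM READ AS CONDITIONAL SPREADING: granted Prop. 6.1 / Thm. 11.5.11,
  `CMToAbelian ↔ (HC_CM → UniformAlgebraicityAtCMPoints) ↔ (HC_CM → AlgebraicityLocusClosedOnCMDenseFamilies)
  ↔ (HC_CM → AbelianSchemeVHC)`: the tree's open reduction item IS the statement "under Hodge-for-CM,
  algebraicity spreads from the CM locus of every CM-dense abelian family" — no more, no less.
* §D  ABDULALI'S LEMMA 6.2 IN SUMMIT TYPING with the transport input RESTRICTED to the printed CM-dense
  Mumford–Tate families (`Abdulali1994.InvariantCyclesHoldFor` asked only of families satisfying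
  `Deligne1982.IsCMDenseMumfordTateFamilyFor A p c` — the ABSTRACT class of CM-dense abelian families with a
  CM chart, which CONTAINS Abdulali's "Kuga fiber varieties of Hodge type" (ref1 F15); below "IC_MT"), its exactness
  `HC_AV ↔ HC_CM ∧ IC_MT` and item reading `CMToAbelian ↔ (HC_CM → IC_MT)` modulo the fact, and THE ORDER OF
  THE TYPED SPREADING INPUTS, unconditionally and with no print: `AbelianSchemeVHC ⟹ IC_MT ⟹ U ⟸ H4`
  (`uniformAlgebraicityAtCMPoints_of_invariantCyclesOnMTFamilies`: a family in row U's scope with a CM fibre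
  IS one of the printed families, anchored there) — so U (part II) is the WEAKEST typed input of the cell's
  deform axis, and modulo `HC_CM` alone `IC_MT ↔ U` (`invariantCyclesOnMTFamilies_iff_uniform_of_HC_CM`).

HONEST COLUMN (RING2-MAP §deform D.8–D.10). Nothing here is a case of the Hodge conjecture; `HC_CM` is not
discharged anywhere. What changed: the rows' family hypotheses are now consequences of ONE cited refereed
Literature fact, so `HC_AV ↔ HC_CM ∧ U` (row U, `HC_CM` a genuine factor) and `HC_AV ↔ AbelianSchemeVHC` (row V/M,
`HC_CM` dominated) hold outright modulo print. In print IC_MT ALSO dominates `HC_CM` (Abdulali 1994 Thm. 6.1 (a):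
the Weil/André families are Kuga fibre varieties of Hodge type with unconditional anchors); in the kernel that is
NOT visible (the tree's Weil-family facts carry no density / quasi-projectivity clause), so for IC_MT only the
exactness WITH `HC_CM` is a kernel theorem; whether U (the weakest input) implies `HC_CM` is open in print too.

References: [Deligne1982HodgeCycles] Prop. 6.1, pp. 71–73, Milne 2003 re-edition endnote 19; [CharlesSchnell2014Notes]
Conj. 11.3.1, Cor. 11.3.6, Prop. 11.3.11, Thm. 11.5.11; [Abdulali1994FamiliesAV] (1.1), Lemma 6.2, Thm. 6.1 (a);
[Andre1996Motifs] §6.3 Remarque 2; [Milne1999] §2. PerL / QW8 / the 2001 programme are cited nowhere.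
-/

-- namespace `…Ring2.Deform` as parts I–II (the cell's `Summits/HodgeConjecture/Ring2/` is not allowlisted).
set_option linter.dupNamespace false
noncomputable section
namespace Summit.HodgeConjecture.HodgeConjecture.Ring2.Deform

open CategoryTheory AlgebraicGeometry
open Literature.AlgebraicGeometry Literature.AlgebraicGeometry.Motives
open Literature.AlgebraicGeometry.HodgeTheory
open Literature.AlgebraicGeometry.Abdulali1994 (deligne1982_exists_cmAnchoredHodgeFamily
  IsCMAnchoredHodgeFamilyFor InvariantCyclesHoldFor)
open Literature.AlgebraicGeometry.Deligne1982 (deligne1982_cmDenseMumfordTateFamilies IsCMDenseMumfordTateFamilyFor)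
open Summit.HodgeConjecture.HodgeConjecture
open Summit.HodgeConjecture.HodgeConjecture.WeilTypeLadder
open Summit.HodgeConjecture.HodgeConjecture.Theses
open Summit.HodgeConjecture.HodgeConjecture.Ring2.Hypotheses (AbelianSchemeVHC MumfordTateCMAnchors)
open Summit.HodgeConjecture.HodgeConjecture.Theorems.HodgeAbelianVarieties.Negative (iff_hodgeConjecture_restricted)

variable {𝒳 S : SchemeOver ℂ}

/-! ## §A The bridges: summit-side family hypotheses = the cited refereed Literature facts -/

/-- The two `cmLocus` (part II's; `Deligne1982`'s) are the SAME set, definitionally.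
[cite: Deligne1982HodgeCycles, §6 proof of Prop. 6.1 (p. 73)] -/
theorem cmLocus_eq_deligne1982 (f : 𝒳 ⟶ S) (n : ℕ) : Deligne1982.cmLocus f n = cmLocus f n := rfl

/-- **Bridge (dense form), both directions.** The summit-side hypothesis `CMDenseMumfordTateFamilies`
(part II, row U's family input) is, binder for binder, the refereed named fact
`Deligne1982.deligne1982_cmDenseMumfordTateFamilies` (Charles–Schnell Thm. 11.5.11 (a)(b)(c) with the density
clause / Deligne Prop. 6.1 + proof). [cite: CharlesSchnell2014Notes, Thm. 11.5.11 (a)–(c) (p. 516)]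
[cite: Deligne1982HodgeCycles, Prop. 6.1 and proof (pp. 71–73)] -/
theorem cmDenseMumfordTateFamilies_iff_deligne1982 :
    CMDenseMumfordTateFamilies ↔ deligne1982_cmDenseMumfordTateFamilies := Iff.rfl

/-- **Bridge (dense form)**: the refereed fact supplies row U's family hypothesis.
[cite: CharlesSchnell2014Notes, Thm. 11.5.11] -/
theorem cmDenseMumfordTateFamilies_of_deligne1982 (h : deligne1982_cmDenseMumfordTateFamilies) :
    CMDenseMumfordTateFamilies :=
  cmDenseMumfordTateFamilies_iff_deligne1982.2 h

/-- **Bridge (one-CM-fibre form), both directions.** The summit-side hypothesis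
`Hypotheses.MumfordTateCMAnchors` (part I's `MTAnchors[]`, stub 1 of the registered skeleton of item 16267)
is the literature seat's named fact `Abdulali1994.deligne1982_exists_cmAnchoredHodgeFamily` (Deligne
Prop. 6.1 (a)(b) with "for some `s₁`, `Y_{s₁}` is of CM-type"), repackaged: the summit node spells the CM clause
as the body of `Milne1999.IsOfCMType`. [cite: Deligne1982HodgeCycles, Prop. 6.1 (a)–(c)]
[cite: Abdulali1994FamiliesAV, proof of Lemma 6.2 (p. 1131)] -/
theorem mumfordTateCMAnchors_iff_deligne1982_exists_cmAnchored :
    MumfordTateCMAnchors ↔ deligne1982_exists_cmAnchoredHodgeFamily := by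
  constructor
  · intro h A hA p c hc hpp
    obtain ⟨𝒳, S, f, s₁, s₀, e, W, A₀, hf, hirr, hsm, hab, hW, hWc, hdim₀, he₀, hcm₀⟩ := h A hA p c hc hpp
    exact ⟨𝒳, S, f, hf, hirr, hsm, hab, s₁, s₀, e, W, A₀, hW, hWc, hdim₀, he₀, hcm₀⟩
  · exact Deligne1982.exists_flat_cmAnchoredHodgeFamily_of_exists_cmAnchored

/-- **Bridge (one-CM-fibre form)**: the fact supplies part I's anchor hypothesis.
[cite: Deligne1982HodgeCycles, Prop. 6.1] -/
theorem mumfordTateCMAnchors_of_deligne1982_exists_cmAnchored (h : deligne1982_exists_cmAnchoredHodgeFamily) :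
    MumfordTateCMAnchors :=
  mumfordTateCMAnchors_iff_deligne1982_exists_cmAnchored.2 h

/-- … and the dense fact supplies it too (part II's `mumfordTateCMAnchors_of_cmDense`).
[cite: Deligne1982HodgeCycles, Prop. 6.1 and proof p. 71] -/
theorem mumfordTateCMAnchors_of_deligne1982 (h : deligne1982_cmDenseMumfordTateFamilies) :
    MumfordTateCMAnchors :=
  mumfordTateCMAnchors_of_cmDense (cmDenseMumfordTateFamilies_of_deligne1982 h)

/-! ## §B The rows of the deform axis with the family input discharged to print -/

/-- **ROW U, print-backed**: `HC_CM ∧ UniformAlgebraicityAtCMPoints ⟹ HC_AV` granted only the refereed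
fact (Thm. 11.5.11 with density). `HC_CM` is consumed at every CM fibre of the Mumford–Tate family (part II);
U is OPEN with no print. [cite: CharlesSchnell2014Notes, Thm. 11.5.11 and Prop. 11.3.11]
[cite: Deligne1982HodgeCycles, Prop. 6.1 and Thm. 2.12] -/
theorem HC_AV_of_deligne1982_of_HC_CM_of_uniform (hF : deligne1982_cmDenseMumfordTateFamilies)
    (hCM : RankFourFaces.CMAbelianHodge) (hU : UniformAlgebraicityAtCMPoints) :
    PadicSemiregularLift.HodgeAbelianVarieties :=
  HC_AV_of_HC_CM_of_cmDense_of_uniform hCM (cmDenseMumfordTateFamilies_of_deligne1982 hF) hU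

/-- **EXACTNESS of row U, print-backed**: `HC_AV ↔ HC_CM ∧ U` modulo the refereed fact alone — the ONE
typed open `Prop` between `HC_CM` and `HC_AV` on the deform axis is U, and `HC_CM` is a genuine factor
(not known to follow from U; part II HONEST COLUMN (1)). [cite: CharlesSchnell2014Notes, Cor. 11.3.6 and
Thm. 11.5.11] -/
theorem HC_AV_iff_HC_CM_and_uniform_of_deligne1982 (hF : deligne1982_cmDenseMumfordTateFamilies) :
    PadicSemiregularLift.HodgeAbelianVarieties ↔
      (RankFourFaces.CMAbelianHodge ∧ UniformAlgebraicityAtCMPoints) :=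
  HC_AV_iff_HC_CM_and_uniform (cmDenseMumfordTateFamilies_of_deligne1982 hF)

/-- **Row H4, print-backed**: `HC_AV ↔ HC_CM ∧ AlgebraicityLocusClosedOnCMDenseFamilies` modulo the
refereed fact (Principle B's closedness asked of algebraic classes; NOT KNOWN).
[cite: Deligne1982HodgeCycles, Thm. 2.12 and Prop. 6.1] [cite: CharlesSchnell2014Notes, Prop. 11.3.11] -/
theorem HC_AV_iff_HC_CM_and_locusClosed_of_deligne1982 (hF : deligne1982_cmDenseMumfordTateFamilies) :
    PadicSemiregularLift.HodgeAbelianVarieties ↔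
      (RankFourFaces.CMAbelianHodge ∧ AlgebraicityLocusClosedOnCMDenseFamilies) :=
  HC_AV_iff_HC_CM_and_locusClosed (cmDenseMumfordTateFamilies_of_deligne1982 hF)

/-- **Row V, print-backed** (part I (V) = the `CMToAbelian_of` composition of item 16267's registered
skeleton, with stub 1 `MumfordTateCMAnchors` DISCHARGED to Deligne Prop. 6.1): `HC_CM ∧ AbelianSchemeVHC
⟹ HC_AV`. [cite: Deligne1982HodgeCycles, Prop. 6.1] [cite: CharlesSchnell2014Notes, Conj. 11.3.1] -/
theorem HC_AV_of_deligne1982_of_HC_CM_of_abelianSchemeVHC (h₁₄ : deligne1982_exists_cmAnchoredHodgeFamily)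
    (hCM : RankFourFaces.CMAbelianHodge) (hV : AbelianSchemeVHC) :
    PadicSemiregularLift.HodgeAbelianVarieties :=
  Hypotheses.hc_av_of_hc_cm_of_mumfordTateCMAnchors_of_abelianSchemeVHC hCM
    (mumfordTateCMAnchors_of_deligne1982_exists_cmAnchored h₁₄) hV

/-- **Exactness of row V, print-backed**: `HC_AV ↔ HC_CM ∧ AbelianSchemeVHC` modulo Prop. 6.1 — but see the
next theorem: on this row `HC_CM` is dominated. [cite: CharlesSchnell2014Notes, Cor. 11.3.6]
[cite: Deligne1982HodgeCycles, Prop. 6.1] -/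
theorem HC_AV_iff_HC_CM_and_abelianSchemeVHC_of_deligne1982 (h₁₄ : deligne1982_exists_cmAnchoredHodgeFamily) :
    PadicSemiregularLift.HodgeAbelianVarieties ↔ (RankFourFaces.CMAbelianHodge ∧ AbelianSchemeVHC) :=
  Hypotheses.hc_av_iff_hc_cm_and_abelianSchemeVHC (mumfordTateCMAnchors_of_deligne1982_exists_cmAnchored h₁₄)

/-- **Row M (Milne's endnote 19), anchors print-backed**: `AbelianSchemeVHC ⟹ HC_AV` with NO `HC_CM`
hypothesis, modulo André 1992 (tree fact), Deligne's tensor-anchored Weil families (tree fact), Deligne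
Prop. 6.1 (literature fact) and the OPEN anchored leaf R3anc `WeilTypeLadder.AnchoredWeilFamiliesCMField` of
the Weil-type ladder (in print: André 1996 Lemme 6.3.3 for split type; the tree's André-1992 fact forgets
split-ness — RING2-MAP §deform D.1 row V). [cite: Deligne1982HodgeCycles, Milne 2003 re-edition endnote 19]
[cite: Andre1996Motifs, §6.3 Lemmes 6.3.2–6.3.3 and Remarque 2] [cite: Abdulali1994FamiliesAV, Thm. 6.1 (a)] -/
theorem HC_AV_of_abelianSchemeVHC_of_deligne1982
    (h𝔄 : Andre1992_hodgeClasses_cmAbelianVariety_mem_span_pullback_weilClasses)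
    (hD : deligne1982_weilFamily_hodgeWeilSection_all) (hanc : AnchoredWeilFamiliesCMField)
    (h₁₄ : deligne1982_exists_cmAnchoredHodgeFamily) (hV : AbelianSchemeVHC) :
    PadicSemiregularLift.HodgeAbelianVarieties :=
  Hypotheses.hc_av_of_abelianSchemeVHC h𝔄 hD hanc (mumfordTateCMAnchors_of_deligne1982_exists_cmAnchored h₁₄) hV

/-- … so on row V, modulo the same printed inputs and R3anc, `HC_AV ↔ AbelianSchemeVHC`: the `HC_CM` factor
of `HC_AV_iff_HC_CM_and_abelianSchemeVHC_of_deligne1982` is decorative (contrast row U).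
[cite: Deligne1982HodgeCycles, Milne 2003 re-edition endnote 19] [cite: Andre1996Motifs, §6.3 Remarque 2] -/
theorem HC_AV_iff_abelianSchemeVHC_of_deligne1982
    (h𝔄 : Andre1992_hodgeClasses_cmAbelianVariety_mem_span_pullback_weilClasses)
    (hD : deligne1982_weilFamily_hodgeWeilSection_all) (hanc : AnchoredWeilFamiliesCMField)
    (h₁₄ : deligne1982_exists_cmAnchoredHodgeFamily) :
    PadicSemiregularLift.HodgeAbelianVarieties ↔ AbelianSchemeVHC :=
  Hypotheses.hc_av_iff_abelianSchemeVHC h𝔄 hD hanc (mumfordTateCMAnchors_of_deligne1982_exists_cmAnchored h₁₄)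

/-! ## §C The reduction item `CMToAbelian` = conditional spreading from the CM locus (granted print) -/

/-- **`CMToAbelian ↔ (HC_CM → U)`.** Granted Charles–Schnell Thm. 11.5.11, the tree's OPEN reduction item
"Hodge for CM abelian varieties ⟹ Hodge for all abelian varieties" (`RankFourFaces.CMToAbelian`,
stmt-HodgeConjecture-16267) is EQUIVALENT to: "under `HC_CM`, on every CM-dense abelian family a
fibrewise-Hodge global class algebraic at all CM fibres is uniformly algebraic along the CM locus".
(→): `HC_CM ∧ CMToAbelian = HC_AV ⟹ U` (on-path, part II). (←): row U. So the item is neither more nor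
less than conditional variational Hodge from the dense CM set. [cite: CharlesSchnell2014Notes, Thm. 11.5.11,
Conj. 11.3.1 and Cor. 11.3.6] [cite: Deligne1982HodgeCycles, Prop. 6.1] -/
theorem cmToAbelian_iff_HC_CM_imp_uniform (hF : deligne1982_cmDenseMumfordTateFamilies) :
    RankFourFaces.CMToAbelian ↔ (RankFourFaces.CMAbelianHodge → UniformAlgebraicityAtCMPoints) := by
  constructor
  · intro h hCM
    exact uniformAlgebraicityAtCMPoints_of_HC_AV (Hypotheses.hc_av_iff_hc_cm_and_cmToAbelian.2 ⟨hCM, h⟩)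
  · intro h hCM A _
    exact HC_AV_of_deligne1982_of_HC_CM_of_uniform hF hCM (h hCM) A

/-- **`CMToAbelian ↔ (HC_CM → H4)`** granted the same fact (H4 = the algebraicity locus is closed on
CM-dense abelian families). [cite: CharlesSchnell2014Notes, Thm. 11.5.11 and Prop. 11.3.11] -/
theorem cmToAbelian_iff_HC_CM_imp_locusClosed (hF : deligne1982_cmDenseMumfordTateFamilies) :
    RankFourFaces.CMToAbelian ↔
      (RankFourFaces.CMAbelianHodge → AlgebraicityLocusClosedOnCMDenseFamilies) := by
  constructor
  · intro h hCM
    exact algebraicityLocusClosedOnCMDenseFamilies_of_HC_AV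
      (Hypotheses.hc_av_iff_hc_cm_and_cmToAbelian.2 ⟨hCM, h⟩)
  · intro h hCM A _
    exact (HC_AV_iff_HC_CM_and_locusClosed_of_deligne1982 hF).2 ⟨hCM, h hCM⟩ A

/-- **`CMToAbelian ↔ (HC_CM → AbelianSchemeVHC)`** granted Deligne Prop. 6.1 (one CM fibre): the item is
also "under `HC_CM`, the variational Hodge conjecture for abelian schemes".
[cite: Deligne1982HodgeCycles, Prop. 6.1] [cite: CharlesSchnell2014Notes, Conj. 11.3.1 and Cor. 11.3.6] -/
theorem cmToAbelian_iff_HC_CM_imp_abelianSchemeVHC (h₁₄ : deligne1982_exists_cmAnchoredHodgeFamily) :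
    RankFourFaces.CMToAbelian ↔ (RankFourFaces.CMAbelianHodge → AbelianSchemeVHC) := by
  constructor
  · intro h hCM
    exact Hypotheses.abelianSchemeVHC_of_hc_av (Hypotheses.hc_av_iff_hc_cm_and_cmToAbelian.2 ⟨hCM, h⟩)
  · intro h hCM A _
    exact HC_AV_of_deligne1982_of_HC_CM_of_abelianSchemeVHC h₁₄ hCM (h hCM) A

/-- **The item from U alone, print-backed**: `U ⟹ CMToAbelian` (part II's `cmToAbelian_of_cmDense_of_uniform`,
family input discharged) — a typed conditional TOWARD the open item. [cite: CharlesSchnell2014Notes, Thm. 11.5.11] -/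
theorem cmToAbelian_of_deligne1982_of_uniform (hF : deligne1982_cmDenseMumfordTateFamilies)
    (hU : UniformAlgebraicityAtCMPoints) : RankFourFaces.CMToAbelian :=
  (cmToAbelian_iff_HC_CM_imp_uniform hF).2 fun _ => hU

/-- ON-PATH: the right-hand sides of §C follow from the Hodge conjecture (no binder exceeds the summit). [folklore] -/
theorem conditionalSpreading_of_hodgeConjecture (h : _root_.HodgeConjecture) :
    (RankFourFaces.CMAbelianHodge → UniformAlgebraicityAtCMPoints) ∧
      (RankFourFaces.CMAbelianHodge → AlgebraicityLocusClosedOnCMDenseFamilies) ∧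
      (RankFourFaces.CMAbelianHodge → AbelianSchemeVHC) :=
  ⟨fun _ => uniformAlgebraicityAtCMPoints_of_hodgeConjecture h,
    fun _ => algebraicityLocusClosedOnCMDenseFamilies_of_HC_AV (HC_AV_of_hodgeConjecture h),
    fun _ => Hypotheses.abelianSchemeVHC_of_hodgeConjecture h⟩

/-! ## §D Abdulali 1994, Lemma 6.2 in summit typing, transport asked only of the printed families -/

/-- **Abdulali's Lemma 6.2, summit-typed, transport restricted to CM-dense abelian families with a CM chart.**
If Grothendieck's invariant-cycles statement (1.1) (`Abdulali1994.InvariantCyclesHoldFor`: one algebraic fibre ⟹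
every fibre) holds on every family satisfying the ABSTRACT predicate `Deligne1982.IsCMDenseMumfordTateFamilyFor A p c`
(the class containing the printed Mumford–Tate families of Thm. 11.5.11 and Abdulali's Kuga fibre varieties of
Hodge type with a CM point; NOT only those — ref1 F15), then `HC_CM ⟹ HC_AV`. Assembled from the literature
seat's PROVED `Deligne1982.hodgeConjecture_abelian_of_cm_of_invariantCycles_cmDense` (whose CM hypothesis
`∀ A, Milne1999.CMHodgeHypothesisAt A` IS `HC_CM`, `Iff.rfl`) and the guard `iff_hodgeConjecture_restricted`.
HONEST COLUMN: in PRINT this restricted input already proves `HC_CM` by itself (Abdulali Thm. 6.1 (a): the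
anchored Weil / André families are such families) — `HC_CM` dominated; in the KERNEL that domination is not
visible (the tree's Weil-family facts `deligne1982_weilFamily_hodgeWeilSection_all` / R3anc carry no density
or quasi-projectivity clause), so the only kernel `iff` for this row is the one WITH `HC_CM`
(`HC_AV_iff_HC_CM_and_invariantCyclesOnMTFamilies_of_deligne1982` below).
[cite: Abdulali1994FamiliesAV, Lemma 6.2 (p. 1131) and Thm. 6.1 (a)] [cite: CharlesSchnell2014Notes, Thm. 11.5.11] -/
theorem HC_AV_of_deligne1982_of_HC_CM_of_invariantCyclesOnMTFamilies
    (hF : deligne1982_cmDenseMumfordTateFamilies) (hCM : RankFourFaces.CMAbelianHodge)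
    (hIC : ∀ (A : AbelianVariety ℂ) (p : ℕ) (c : complexBetti A.X (2 * p)) (𝒳 S : SchemeOver ℂ)
      (f : 𝒳 ⟶ S), IsCMDenseMumfordTateFamilyFor A p c f → InvariantCyclesHoldFor f A.dim) :
    PadicSemiregularLift.HodgeAbelianVarieties :=
  iff_hodgeConjecture_restricted.2
    (Deligne1982.hodgeConjecture_abelian_of_cm_of_invariantCycles_cmDense hF hIC hCM)

/-- The same in the item-16267 typing: restricted transport ⟹ `CMToAbelian`.
[cite: Abdulali1994FamiliesAV, Lemma 6.2 (p. 1131)] -/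
theorem cmToAbelian_of_deligne1982_of_invariantCyclesOnMTFamilies
    (hF : deligne1982_cmDenseMumfordTateFamilies)
    (hIC : ∀ (A : AbelianVariety ℂ) (p : ℕ) (c : complexBetti A.X (2 * p)) (𝒳 S : SchemeOver ℂ)
      (f : 𝒳 ⟶ S), IsCMDenseMumfordTateFamilyFor A p c f → InvariantCyclesHoldFor f A.dim) :
    RankFourFaces.CMToAbelian :=
  fun hCM A _ => HC_AV_of_deligne1982_of_HC_CM_of_invariantCyclesOnMTFamilies hF hCM hIC A

/-- **Comparison of transport inputs**: the blanket `AbelianSchemeVHC` gives IC_MT (a CM-dense Mumford–Tate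
family is a smooth projective abelian family over a smooth irreducible base); converse not claimed.
[cite: CharlesSchnell2014Notes, Conj. 11.3.1] [cite: Abdulali1994FamiliesAV, (1.1) (p. 1122)] -/
theorem invariantCyclesOnMTFamilies_of_abelianSchemeVHC (hV : AbelianSchemeVHC) :
    ∀ (A : AbelianVariety ℂ) (p : ℕ) (c : complexBetti A.X (2 * p)) (𝒳 S : SchemeOver ℂ) (f : 𝒳 ⟶ S),
      IsCMDenseMumfordTateFamilyFor A p c f → InvariantCyclesHoldFor f A.dim := by
  intro A p c 𝒳 S f hfam
  obtain ⟨s₁, e, W, hf, _, _, hirr, hsm, hab, _⟩ := hfam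
  intro q W' hW' h₀ s
  exact hV f hf hirr hsm hab q W' hW' h₀ s

/-- **Under `HC_CM`, row U's input also gives the restricted transport** (on a CM-dense family `HC_CM` makes
the class algebraic at all CM fibres, U spreads it everywhere, so (1.1) holds with or without its anchor):
modulo `HC_CM` and print the three transport inputs `AbelianSchemeVHC`, restricted (1.1), U coincide with
`HC_AV` (§C). [cite: CharlesSchnell2014Notes, Thm. 11.5.11 and Conj. 11.3.1] -/
theorem invariantCyclesOnMTFamilies_of_HC_CM_of_uniform (hCM : RankFourFaces.CMAbelianHodge)
    (hU : UniformAlgebraicityAtCMPoints) :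
    ∀ (A : AbelianVariety ℂ) (p : ℕ) (c : complexBetti A.X (2 * p)) (𝒳 S : SchemeOver ℂ) (f : 𝒳 ⟶ S),
      IsCMDenseMumfordTateFamilyFor A p c f → InvariantCyclesHoldFor f A.dim := by
  intro A p c 𝒳 S f hfam
  obtain ⟨s₁, e, W, hf, h𝒳, hS, hirr, hsm, hab, _, _, hDense⟩ := hfam
  intro q W' hW' _ s
  have hcmAlg := forall_cmLocus_mem_algebraicClasses_of_HC_CM hCM f W' hW'
  obtain ⟨W₀, hW₀c, hW₀alg, hcmW₀⟩ := hU f hf h𝒳 hS hirr hsm hab hDense q W' hW' hcmAlg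
  exact forall_mem_algebraicClasses_of_dense_of_subset_closed f hDense hW₀c hW₀alg hcmW₀ s

/-- ON-PATH for §D: `HC_AV ⟹ IC_MT` (through `Hypotheses.abelianSchemeVHC_of_hc_av`). [cite: CharlesSchnell2014Notes, Cor. 11.3.6] -/
theorem invariantCyclesOnMTFamilies_of_HC_AV (h : PadicSemiregularLift.HodgeAbelianVarieties) :
    ∀ (A : AbelianVariety ℂ) (p : ℕ) (c : complexBetti A.X (2 * p)) (𝒳 S : SchemeOver ℂ) (f : 𝒳 ⟶ S),
      IsCMDenseMumfordTateFamilyFor A p c f → InvariantCyclesHoldFor f A.dim :=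
  invariantCyclesOnMTFamilies_of_abelianSchemeVHC (Hypotheses.abelianSchemeVHC_of_hc_av h)

/-- **IC_MT ⟹ U, unconditionally (no `HC_CM`, no print).** A family in row U's scope with a CM fibre `s₀`
IS a printed family (`IsCMDenseMumfordTateFamilyFor A₀ p (e₀^* W|_{s₀}) f`, `A₀` the CM chart at `s₀`), U's
premise makes `W` algebraic at `s₀`, and restricted invariant cycles spread it to every fibre (`W₀ := S`; with
empty CM locus `W₀ := ∅`). So the typed spreading inputs are ORDERED above U: `AbelianSchemeVHC ⟹ IC_MT ⟹ U`,
`H4 ⟹ U` (part II) — all kernel, unconditional. [cite: Abdulali1994FamiliesAV, (1.1) (p. 1122) and Lemma 6.2]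
[cite: CharlesSchnell2014Notes, Thm. 11.5.11] -/
theorem uniformAlgebraicityAtCMPoints_of_invariantCyclesOnMTFamilies
    (hIC : ∀ (A : AbelianVariety ℂ) (p : ℕ) (c : complexBetti A.X (2 * p)) (𝒳 S : SchemeOver ℂ)
      (f : 𝒳 ⟶ S), IsCMDenseMumfordTateFamilyFor A p c f → InvariantCyclesHoldFor f A.dim) :
    UniformAlgebraicityAtCMPoints := by
  intro n 𝒳 S f hf h𝒳 hS hirr hsm hab hDense p W hW hcmAlg
  by_cases hne : (cmLocus f n).Nonempty
  · obtain ⟨s₀, A₀, ⟨e₀⟩, hdim₀, hcm₀⟩ := hne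
    subst hdim₀
    have hfam : IsCMDenseMumfordTateFamilyFor A₀ p
        (complexBetti.map e₀.hom (2 * p) (complexBetti.map (fiberι f s₀) (2 * p) W)) f :=
      ⟨s₀, e₀, W, hf, h𝒳, hS, hirr, hsm, hab, hW, rfl, hDense⟩
    have hall := hIC A₀ p _ 𝒳 S f hfam p W hW ⟨s₀, hcmAlg s₀ ⟨A₀, ⟨e₀⟩, rfl, hcm₀⟩⟩
    exact ⟨Set.univ, isClosed_univ, fun t _ => hall t, fun s _ => Set.mem_univ _⟩
  · exact ⟨∅, isClosed_empty, fun t ht => absurd ht (by simp), fun s hs => (hne ⟨s, hs⟩).elim⟩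

/-- **Modulo `HC_CM` alone, IC_MT and U coincide** (no print). [cite: Abdulali1994FamiliesAV, (1.1) and Lemma 6.2] -/
theorem invariantCyclesOnMTFamilies_iff_uniform_of_HC_CM (hCM : RankFourFaces.CMAbelianHodge) :
    (∀ (A : AbelianVariety ℂ) (p : ℕ) (c : complexBetti A.X (2 * p)) (𝒳 S : SchemeOver ℂ) (f : 𝒳 ⟶ S),
        IsCMDenseMumfordTateFamilyFor A p c f → InvariantCyclesHoldFor f A.dim) ↔
      UniformAlgebraicityAtCMPoints :=
  ⟨uniformAlgebraicityAtCMPoints_of_invariantCyclesOnMTFamilies,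
    invariantCyclesOnMTFamilies_of_HC_CM_of_uniform hCM⟩

/-- **EXACTNESS of the IC_MT row, print-backed**: `HC_AV ↔ HC_CM ∧ IC_MT` modulo the refereed fact
(`→`: on-path, `HC_AV ⟹ HC_CM` and `HC_AV ⟹ IC_MT`; `←`: Abdulali's Lemma 6.2). Whether IC_MT alone gives
`HC_AV` is Abdulali's Thm. 6.1 (a) in print and NOT a kernel theorem (see the HONEST COLUMN).
[cite: Abdulali1994FamiliesAV, Lemma 6.2 and Thm. 6.1 (a)] [cite: CharlesSchnell2014Notes, Cor. 11.3.6 and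
Thm. 11.5.11] -/
theorem HC_AV_iff_HC_CM_and_invariantCyclesOnMTFamilies_of_deligne1982
    (hF : deligne1982_cmDenseMumfordTateFamilies) :
    PadicSemiregularLift.HodgeAbelianVarieties ↔
      (RankFourFaces.CMAbelianHodge ∧
        ∀ (A : AbelianVariety ℂ) (p : ℕ) (c : complexBetti A.X (2 * p)) (𝒳 S : SchemeOver ℂ) (f : 𝒳 ⟶ S),
          IsCMDenseMumfordTateFamilyFor A p c f → InvariantCyclesHoldFor f A.dim) :=
  ⟨fun h => ⟨HC_CM_of_HC_AV h, invariantCyclesOnMTFamilies_of_HC_AV h⟩,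
    fun h => HC_AV_of_deligne1982_of_HC_CM_of_invariantCyclesOnMTFamilies hF h.1 h.2⟩

/-- **`CMToAbelian ↔ (HC_CM → IC_MT)`** granted the fact: the open item 16267 is also "under `HC_CM`,
Grothendieck's invariant-cycles statement (1.1) on the printed CM-dense Mumford–Tate families".
[cite: Abdulali1994FamiliesAV, (1.1) and Lemma 6.2] [cite: CharlesSchnell2014Notes, Thm. 11.5.11] -/
theorem cmToAbelian_iff_HC_CM_imp_invariantCyclesOnMTFamilies (hF : deligne1982_cmDenseMumfordTateFamilies) :
    RankFourFaces.CMToAbelian ↔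
      (RankFourFaces.CMAbelianHodge →
        ∀ (A : AbelianVariety ℂ) (p : ℕ) (c : complexBetti A.X (2 * p)) (𝒳 S : SchemeOver ℂ) (f : 𝒳 ⟶ S),
          IsCMDenseMumfordTateFamilyFor A p c f → InvariantCyclesHoldFor f A.dim) := by
  constructor
  · intro h hCM
    exact invariantCyclesOnMTFamilies_of_HC_AV (Hypotheses.hc_av_iff_hc_cm_and_cmToAbelian.2 ⟨hCM, h⟩)
  · intro h hCM A _
    exact HC_AV_of_deligne1982_of_HC_CM_of_invariantCyclesOnMTFamilies hF hCM (h hCM) A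

/-! ## §E One-line summary of the deform axis after discharge (for RING2-MAP §deform D.8) -/

/-- **The deform axis, print-backed, in one statement.** Granted the refereed fact (Thm. 11.5.11 with
density, hence Prop. 6.1): `HC_AV ↔ HC_CM ∧ U ↔ HC_CM ∧ H4 ↔ HC_CM ∧ AbelianSchemeVHC`, and the reduction
item `CMToAbelian ↔ (HC_CM → U)`. Every right-hand open `Prop` is a consequence of the Hodge conjecture
(`rowU_inputs_of_hodgeConjecture`, `conditionalSpreading_of_hodgeConjecture`); `HC_CM` is a hypothesis by
name throughout. [cite: CharlesSchnell2014Notes, Thm. 11.5.11, Conj. 11.3.1, Cor. 11.3.6 and Prop. 11.3.11]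
[cite: Deligne1982HodgeCycles, Prop. 6.1 and Thm. 2.12] -/
theorem deformAxis_printBacked (hF : deligne1982_cmDenseMumfordTateFamilies) :
    (PadicSemiregularLift.HodgeAbelianVarieties ↔
        (RankFourFaces.CMAbelianHodge ∧ UniformAlgebraicityAtCMPoints)) ∧
      (PadicSemiregularLift.HodgeAbelianVarieties ↔
        (RankFourFaces.CMAbelianHodge ∧ AlgebraicityLocusClosedOnCMDenseFamilies)) ∧
      (PadicSemiregularLift.HodgeAbelianVarieties ↔ (RankFourFaces.CMAbelianHodge ∧ AbelianSchemeVHC)) ∧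
      (RankFourFaces.CMToAbelian ↔ (RankFourFaces.CMAbelianHodge → UniformAlgebraicityAtCMPoints)) :=
  ⟨HC_AV_iff_HC_CM_and_uniform_of_deligne1982 hF, HC_AV_iff_HC_CM_and_locusClosed_of_deligne1982 hF,
    HC_AV_iff_HC_CM_and_abelianSchemeVHC_of_deligne1982
      (Deligne1982.deligne1982_exists_cmAnchoredHodgeFamily_of_cmDense hF),
    cmToAbelian_iff_HC_CM_imp_uniform hF⟩

#print axioms Summit.HodgeConjecture.HodgeConjecture.Ring2.Deform.HC_AV_iff_HC_CM_and_uniform_of_deligne1982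
#print axioms Summit.HodgeConjecture.HodgeConjecture.Ring2.Deform.cmToAbelian_iff_HC_CM_imp_uniform
#print axioms Summit.HodgeConjecture.HodgeConjecture.Ring2.Deform.HC_AV_of_deligne1982_of_HC_CM_of_invariantCyclesOnMTFamilies
#print axioms Summit.HodgeConjecture.HodgeConjecture.Ring2.Deform.deformAxis_printBacked
#print axioms Summit.HodgeConjecture.HodgeConjecture.Ring2.Deform.uniformAlgebraicityAtCMPoints_of_invariantCyclesOnMTFamilies
#print axioms Summit.HodgeConjecture.HodgeConjecture.Ring2.Deform.HC_AV_iff_HC_CM_and_invariantCyclesOnMTFamilies_of_deligne1982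

end Summit.HodgeConjecture.HodgeConjecture.Ring2.Deform
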